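import Mathlib
import HarnessLib
import HarnessLib.Audit
import Summits.AtomisticToContinuum.Statement
import Literature.MathematicalPhysics.QuantumManyBody.PeriodicBoseGas

/-!
Route: BECRichardsonAnchor

CLOSED (retired) 2026-08-15T13:40:07Z by operator:999:1257524 — reason: not-a-thesis: assembly does not conclude the sub-problem Statement — note: D-0027 §2.1 audit (human 2026-08-15: routes that do not decide the summit are removed): the assembly concludes `Literature.MathematicalPhysics.QuantumManyBody.BoseGas.BoseEinsteinCondensation`, not the sub-problem statement; a NEW conforming route may be opened from the same idea (generated `closes . The file is kept as the record of this route; refuted decls are indexed as negative knowledge (`ledger negatives`).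

# Route BECRichardsonAnchor — Richardson's integrable boson pairing gas as a momentum-space anchor
with thermodynamic-limit BEC, then a typed homotopy to the soft-potential gas that deforms only the
non-integrable vertices

X_R (INTEGRABLE ANCHOR + DEFORMATION; formal; realises card richardson-gaudin-anchor). It suffices
to show
BeliaevDeformationBEC ∧ BoundaryTransferWeak, plus the complement class
UnboundedPotentialPeriodicBEC that this line does not
touch (hard cores; = PeriodicBEC of route BECPeriodicReduction restricted to unbounded v). The
ANCHOR is Richardson's exactly
solvable repulsive su(1,1) boson pairing model placed inside the dilute gas: on the torus of side L
= (N/ρ)^(1/3),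
H_R = Σ_k (k² + Δ·[k≠0]) a†_k a_k + (γ/2V) Σ_{k,k'∈B_Λ} a†_k a†_{−k} a_{−k'} a_{k'}, γ = v̂(0) = ∫v,
matched shift Δ = 2ργ,
band B_Λ = (2π/L){−M..M}³, M = ⌊ΛL/2π⌋ — typed FIRST-QUANTISED over
Literature.MathematicalPhysics.QuantumManyBody.BoseGas as
E_R(Φ) = ∫|∇Φ|² + 2ργ·(N − ⟨Φ,n₀Φ⟩) + (γ/L⁹)·(N(N−1)/2)·∫_(cell^(N−2)) |∫∫ conj(w_Λ(x,y))
Φ(x,y,·)|², w_Λ(x,y) = Σ_{m∈{−M..M}³} e^(2πi m·(x−y)/L)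
(a rank-one projection onto the band-limited zero-pair-momentum s-wave pair, coupling γ·#B_Λ/L³).
Its Bogoliubov quadratic form
coincides with the true gas's at small momenta (pair-excitation cost 2k²+2ργ, pairing amplitude ργ,
pair–pair scattering γ/V
kept, number conserved). RichardsonAnchorBEC (rank 3): thermodynamic-limit BEC in the ground state
of H_R at the Bogoliubov
rate 1 − C√(ργ³). BeliaevDeformationBEC (rank 2): along E_t = periodicEnergy(t·v) + (1−t)·(anchor
terms), t ∈ [0,1], every
bounded finite-range v, near-minimisers keep n₀ ≥ cN with c UNIFORM in t; t = 0 is the anchor, t = 1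
is PeriodicBEC for
bounded v. BoundaryTransferWeak (rank 4, shared with BECPeriodicReduction stmt-0827) carries the
torus statement to the
Dirichlet, mode-free conjunct.
Lean: `BeliaevDeformationBEC ∧ UnboundedPotentialPeriodicBEC ∧ BoundaryTransferWeak`

## Assembly
Pure logic plus the t = 1 specialisation (sorry-free in Sketch.lean, theorem assembly_proof): given
v repulsive finite-range,
case-split on boundedness. Bounded by V₀: BeliaevDeformationBEC with Λ = 1, t = 1 gives ∃ρ₀ ∀ρ ∃c
∀ᶠn the near-minimiser
statement for E_1 = periodicEnergy (fun r => ofReal 1 * v r) + ofReal 0 · (…) = periodicEnergy v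
(simp: ofReal_one, one_mul,
sub_self, ofReal_zero, zero_mul, add_zero), i.e. the PeriodicBEC body for v after the index shift N
= n + 2
(Filter.eventually_atTop); unbounded: UnboundedPotentialPeriodicBEC gives the same body. Then
BoundaryTransferWeak v hv body
yields ∃ρ₀ ∀ρ∈(0,ρ₀) HasGroundStateBEC v ρ, which is BoseEinsteinCondensation. RichardsonAnchorBEC
is the t = 0 case of the
rank-2 crux sharpened to the Bogoliubov rate; it is the informative first target and does not enter
the assembly term
(pattern of GaldiLiouville in the template example).

Rationale: WHY THIS LINE. Thought-starter 29 (integrable member + transfer) pointed at momentum space: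
Bogoliubov's 1947 truncation kept
number-conserving and with pair–pair scattering is Richardson's exactly solvable many-boson model
(Richardson1968; su(1,1)
Richardson–Gaudin family, DukelskySchuck2001, DukelskyPittelSierra2004), whose eigenstates are Bethe
states Π_α B⁺(E_α)|0⟩
with pair energies solving algebraic (Richardson) equations and whose occupations follow by
Hellmann–Feynman
(⟨n_k⟩ = ν_k + Σ_i ∂E_i/∂ε_k, DukelskySchuck2001 eq. after (richar)); thermodynamic limits of Bethe
equations are the one
setting where interacting quantum TL statements are routinely rigorous (LiebLiniger1963;
RomanSierraDukelsky2002 for the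
electrostatic large-N limit of BCS roots), and the approximating-Hamiltonian method
(BogolyubovJrEtAl1984, PuleZagrebnov2007
for the pair boson Hamiltonian of Luban1962) is a second, non-integrable engine for the same anchor.
Imported areas: quantum
integrability (Bethe ansatz / Richardson–Gaudin, continuum limit of roots) and the Bogoliubov-Jr.
min–max method; the
deformation crux is form-factor perturbation theory around an integrable point (Slavnov
determinants) instead of around the
c-number Bogoliubov state. What no prior route does: BECPeriodicReduction files PeriodicBEC "any
method", BECPinning/InfraredBound
are gap/penalty currencies, BECRenormGroup expands around the Gaussian Bogoliubov point; here the
unperturbed point is an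
INTERACTING, number-conserving, exactly solvable Hamiltonian that already carries the 3-D pairing
structure, and the anchor
theorem is a stand-alone provable target (negatives index empty).

RANKED CRUXES. #2 BeliaevDeformationBEC (crux) — (card item RB, typed) For every repulsive
finite-range v that is BOUNDED (v ≤ V₀; hard cores excluded) and every cutoff Λ > 0 there is ρ₀ > 0
such that for 0 < ρ < ρ₀ there is c > 0 with: for every t ∈ [0,1] and all large N (N = n+2, L =
(N/ρ)^(1/3), γ = ∫v(|x|)dx, M = ⌊ΛL/2π⌋), every periodic trial state Ψ whose deformed energy E_t(Ψ)
= periodicEnergy(t·v)(Ψ) + (1−t)·[2ργ(N − n₀(Ψ)) + (γ/L⁹)(N(N−1)/2)∫|∫∫conj(w_Λ)Ψ|²] is within δ =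
δ(N,t) > 0 of its infimum has condensateOccupation ≥ cN. The constant c is uniform along the
homotopy H_t = (1−t)H_R + tH_v; t = 1 is PeriodicBEC (stmt-0826 body) for bounded v, t = 0 is the
anchor. [deps: RichardsonAnchorBEC] [difficulty: open-problem] (why it might fail: For t<1 the
anchor's Δ-term pins the zero mode with extensive strength (1−t)2ργ, so gap arguments give c(t) with
depletion ≲ o(1)/(1−t); uniformity as t→1 is soft-potential PeriodicBEC through the marginal d=3,
T=0 infrared problem (BogoliubovPerturbationInfrared).) [LiebSeiringerSolovejYngvason2005,
Fournais2020, Benfatto1994, CenatiempoGiuliani2014, Griffin1993, Richardson1968,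
Literature.Barriers.AtomisticToContinuum.BogoliubovPerturbationInfrared,
Literature.Barriers.AtomisticToContinuum.KineticGapLengthScales]
#3 RichardsonAnchorBEC (crux) — (card item RA, typed; the anchor theorem) For all γ, Λ > 0 there are
C and ρ₀ > 0 such that for 0 < ρ < ρ₀ and all large N (N = n+2, L = (N/ρ)^(1/3), M = ⌊ΛL/2π⌋), every
periodic trial state Ψ within δ = δ(N) > 0 of the infimum of the anchor energy E_R(Φ) = ∫|∇Φ|² +
2ργ(N − n₀(Φ)) + (γ/L⁹)(N(N−1)/2)∫_(cell^(N−2))|∫∫conj(w_Λ(x,y))Φ(x,y,Y)dxdy|²dY has n₀(Ψ) =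
condensateOccupation ≥ (1 − C√(ργ³))·N: thermodynamic-limit BEC at the Bogoliubov rate for the
ground state of H_R = Σ_k (k²+2ργ[k≠0]) n_k + (γ/2V) Σ_(k,k'∈B_Λ) a†_k a†_(−k) a_(−k') a_(k') —
Richardson's repulsive su(1,1) pairing model (levels k²+Δ, ε₀ = 0, coupling g = 2γ/V), read off its
ground-state Bethe roots (all real, in (2η₀, 2η₁) per DukelskySchuck2001) or, alternatively, by the
approximating-Hamiltonian method plus the model's own V-independent gap. [difficulty: L] (why it
might fail: At Δ=2ργ the anchor is only self-consistently stable (Bogoliubov A(0)−B = 2(ρ−ρ₀)γ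
closes with the depletion); Richardson1968/DukelskySchuck2001 find a FRAGMENTED phase (levels 0,1)
at strong repulsive pairing; PZ2007 Rem 1.2: without exchange shift repulsive pairing is invisible
in the TL.) [Richardson1968, DukelskySchuck2001, DukelskyPittelSierra2004, RomanSierraDukelsky2002,
PuleZagrebnov2007, Luban1962, BogolyubovJrEtAl1984, Nozieres1995]
#4 BoundaryTransferWeak (crux) — (card item RD; verbatim the rank-3 crux
stmt-AtomisticToContinuum-0827 of route BECPeriodicReduction, shared by signature) for each
repulsive finite-range v, the PeriodicBEC conclusion for v (constant-mode occupation ≥ cN for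
δ-near-minimisers of the periodic energy on the torus of side (N/ρ)^(1/3), ρ small) implies ∃ρ₀ > 0
∀ρ ∈ (0,ρ₀) HasGroundStateBEC v ρ (Dirichlet ground state, λ_max(γ) ≥ cN via condensateNumber).
[difficulty: L] (why it might fail: PeriodicBEC(v) is ground-state-only (δ after N) at the box
(N/ρ)^{1/3}: the Dirichlet GS is a periodic trial state but lies a wall term ≫δ above E₀^per;
interior restrictions are neither periodic nor of sharp N, so the hypothesis may never fire
(transfer≈conjunct). BEC is BC-sensitive: Robinson1976.) [LiebSeiringerSolovejYngvason2005,
Basti2022, BoccatoSeiringer2023, Junge2026, Robinson1976, LauwersVerbeureZagrebnov2003]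
#9 UnboundedPotentialPeriodicBEC (support) — The complement class, filed so that the assembly is
honest: for every repulsive finite-range v that is NOT bounded (∀V₀ ∃r, v(r) > V₀ — hard cores v =
⊤·1_[0,a] and other singular profiles) the PeriodicBEC conclusion holds (∃ρ₀ ∀ρ<ρ₀ ∃c ∀ᶠN ∃δ:
δ-near-minimisers of periodicEnergy v on the torus (N/ρ)^(1/3) have condensateOccupation ≥ cN). This
is PeriodicBEC (stmt-AtomisticToContinuum-0826) restricted to unbounded v and closes when 0826
closes; this line offers no mechanism for it (a t-matrix-renormalised anchor would be a different
card). Not to be worked inside this route. [difficulty: open-problem]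
[LiebSeiringerSolovejYngvason2005, Fournais2020, Junge2026]

TWO-LAYER PLAN. Foreseen glued splits (k ≤ 3, depth 1), filed only when a crux closes or stalls:
RichardsonAnchorBEC ⇐ AnchorGroundStateIsBethe (the ground state of H_R in the N-sector is the
Richardson state with all roots in (2η₀,2η₁); completeness in the seniority-zero band sector,
spectators outside the band empty) → AnchorRootAsymptotics (two-scale continuum limit of that root
set at fixed ρ, γ, Λ, with Hellmann–Feynman n₀ = N − Σ_(k≠0)⟨n_k⟩ ≥ (1 − C√(ργ³))N) →
RichardsonAnchorBEC; alternative decomposition (separate route if wanted): approximating-Hamiltonian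
lower bound H_R ≥ H_lin(c) − o(N) plus the anchor gap.
BeliaevDeformationBEC ⇐ PinnedRegime (t ≤ 1 − η: BEC for H_t with c(η) by leading-order energy
bounds against the extensive (1−t)Δ n₊ pinning — provable-now technology,
LiebSeiringerSolovejYngvason2005 Thm 2.4/5.1 style) → EndpointUniformity (η → 0: second-order
form-factor expansion of n₀ around H_R with V-uniform remainder for the cubic condensate–pair
vertices; the UV piece v̂(k) − γ and quartic-excited terms as bounded/relatively small
perturbations) → BeliaevDeformationBEC.
BoundaryTransferWeak ⇐ as planned in BECPeriodicReduction (Neumann bracketing of interior sub-boxes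
+ mode-free criterion λ_max ≥ tr γ²/N).

KILL CRITERIA. ¬BeliaevDeformationBEC witnessed at some t < 1 (a bounded v, small ρ, where H_t does
not condense) closes the route outright
(close --reason refuted:BeliaevDeformationBEC): the homotopy itself is wrong. ¬BeliaevDeformationBEC
witnessed only at t = 1
is ¬PeriodicBEC for a bounded potential: kills this route and BECPeriodicReduction's rank 2 (and,
physically, the conjunct).
¬RichardsonAnchorBEC by FRAGMENTATION/smearing of the anchor at Δ = 2ργ (the DukelskySchuck2001
phase) forces a pivot, not a
close: restate both cruxes with an over-gapped shift Δ' = κ·2ργ, κ > 1 (route edit --restate),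
recording that the matched
anchor sits on the wrong side; ¬RichardsonAnchorBEC with BEC true but depletion ≫ √(ργ³) → restate
rank 3 with ∃c only.
¬BoundaryTransferWeak (Dirichlet walls destroying an existing torus condensate) is shared damage
with BECPeriodicReduction:
pivot the assembly to a Dirichlet-direct transfer (BECPinning-style ∃u statement). PeriodicBEC
(stmt-0826) proved by any
other route moots ranks 2 and 9 for the conjunct; RichardsonAnchorBEC then survives as a
Literature-level theorem/wind tunnel.

NOT DECOMPOSED YET. The second-quantised dictionary (Fock layer on the torus, a_k, the identity
"pair functional = ⟨Ψ, P_Λ†P_Λ Ψ⟩/(2·#B_Λ·…)"),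
filed as a definition request, and the Bethe-ansatz machinery (Richardson equations, Gaudin matrix,
Slavnov form factors) —
layer-2 material under RichardsonAnchorBEC. The choice Δ = 2ργ versus a Δ-interval, odd N /
seniority sectors, ball versus
cube band, and the Λ-dependence of C. The card's RC (operator decomposition H_v − H_R = UV two-body
+ cubic + quartic-excited
with dilute-regime smallness) is a prover-side lemma under rank 2, not an item. The Nepomnyashchy
test (does the anchor's
anomalous self-energy vanish at zero four-momentum?) is a refuter computation, not a statement. Hard
cores / unbounded v
(rank 9) are explicitly outside the mechanism. T > 0 and grand-canonical variants: not here.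

CHEAPEST FALSIFIER. Mean-field/Bogoliubov stability audit of the anchor at the matched shift (pen
and paper or a 50-line sympy/numpy kit job):
minimise the anchor's Hartree–Bogoliubov energy over (a) the k = 0 condensate with Gaussian pair
fluctuations and (b)
condensates smeared/fragmented over the lowest shells (the DukelskySchuck2001 / Richardson1968
fragmented phase and the
Pulé–Zagrebnov generalized-condensation scenario for repulsive pairing without exchange shift,
PuleZagrebnov2007 Rem. 1.2):
by the planner's count moving δN particles out of the zero mode costs (2ρ − ρ₀)γ·δN > 0 and the
Bogoliubov matrix has
A(0) − B = 2(ρ − ρ₀)γ ≥ 0, so (a) should win with depletion ≈ (8/3√π)√(ρa_B³), a_B = γ/8π; if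
instead (b) wins at Δ = 2ργ for
small ρ, rank 3 is false as typed (restate with Δ' > 2ργ). Second cheapest: exact diagonalisation of
H_R in the seniority-zero
su(1,1) pair basis with 4–6 shells, N ≤ 200, scanning L at fixed ρ (kit, minutes): n₀/N must
stabilise in L. Third: the
card's Richardson-equation numerics at N ~ 10³ (DukelskySchuck2001 did N = 1000, L = 50 levels for
the trap). Not run in
this planning pass (one-shot plancard seat; no kit job submitted).

NUMBERS. Anchor coupling g = 2γ/V, γ = v̂(0) = 8πa_B (Born); matched shift Δ = 2ργ reproduces the
Bogoliubov pair cost 2k² + 2ρv̂(k)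
and amplitude ρv̂(k) at v̂(k) → γ; anchor Bogoliubov gap ≈ 2γ√(ρ(ρ−ρ₀)) ~ γρ(ργ³)^(1/4)
(V-independent, closes with the
depletion); expected anchor depletion 1 − n₀/N ≈ (8/(3√π))√(ρa_B³)(1 + O(γΛ)); DukelskySchuck2001:
repulsive ground-state
roots real in (2η₀, 2η₁), fragmentation into levels 0 and 1 beyond a critical g (N = 1000, 50
levels); PuleZagrebnov2007
Thm 1.1: TL pressure of the pair boson Hamiltonian = inf_q inf_ρ p⁽²⁾(q,ρ) for repulsive pairing,
equal to mean-field
thermodynamics (Rem. 1.2, [PZ-Pair]). Printed BEC length scales to beat: L ≲ (ρa)^(-1/2)(ρa³)^(-δ)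
(Fournais2020 Thm 1.2),
R ~ a(ρa³)^(-3/4-η) (Junge2026 Cor. 6). Items at open: 5 (3 cruxes, 1 support, 1 assembly).

DEFINITION REQUESTS. None needed to TYPE the items (all five elaborate over
Literature.MathematicalPhysics.QuantumManyBody.BoseGas, rc 0 in
Sketch.lean). Filed after open, for provers of rank 3: a second-quantised torus layer (bosonic Fock
space over plane waves
φ_k = L^(-3/2)e^(ik·x)1_cell, a_k, a†_k on the N-sector, and the dictionary lemmas cellOccupation N
L φ_k Ψ = ⟨Ψ, a†_k a_k Ψ⟩,
pair functional of this route = ⟨Ψ, P_Λ† P_Λ Ψ⟩ with P_Λ = Σ_(k∈B_Λ) a_(−k) a_k), topic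
Literature/MathematicalPhysics/QuantumManyBody
— without it Richardson's algebra (K⁺_k = a†_k a†_(−k), K⁺₀ = a₀†²/2, su(1,1)) cannot be imported.

Novelty: Searches (2026-08-15): `lit search --source crossref "Richardson exactly solvable boson pairing
model condensate fragmentation"` (12: Richardson1968 doi:10.1063/1.1664719, DukelskySchuck2001
doi:10.1103/physrevlett.86.4207, Pan 2004, Balantekin–Dereli–Pehlivan 2005, Gambacurta 2006 …); `lit
search --source crossref "pair Hamiltonian model boson gas approximating Hamiltonian Bose
condensation Pule Zagrebnov"` (12: PuleZagrebnov2007 doi:10.1142/s0129055x07002924, Pulé–Zagrebnov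
J. Phys. A 2004 doi:10.1088/0305-4470/37/38/002, Luban1962 doi:10.1103/physrev.128.965,
Coniglio–Vasudevan 1970, Pethick–ter Haar 1965, BruZagrebnov1998 doi:10.1088/0305-4470/31/47/002,
Jaeck 2006); `lit search --hybrid "Richardson boson pairing model exact solution condensate"` (8
held books, none treating the repulsive Richardson gas in the TL: griffin1995, iachello1991,
tsuneto1998 …); `lit search --hybrid "approximating Hamiltonian method pair Hamiltonian boson gas
variational principle condensate"` (LSSY2005, Griffin1993, griffin1995 …); `lit galaxy search
"exactly solvable boson pairing" --star all` (panama 0, crabby 0, pdf star queued-out); `lit read`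
doi:10.1103/physrevlett.86.4207 = arXiv:cond-mat/0009057 p. 4 (roots in (2η₀,2η₁), fragmentation for
repulsive pairing, ⟨n_Λ⟩ = ν_Λ + Σ ∂E_i/∂ε_Λ) and doi:10.1142/s0129055x07002924 =
arXiv:math-ph/0603061 pp. 3–5 (Thm 1.1, Rem. 1.2); openalex/arXiv APIs 429 in this pass; card
audit-12 queries (crossref 2005+ su(1,1) RG bosons: Links, Claeys–Lamacraft  [refs: 10.1063/1.1664719, 10.1103/physrevlett.86.4207, 10.1142/s0129055x07002924, 10.1088/0305-4470/37/38/002, 10.1103/physrev.128.965, 10.1088/0305-4470/31/47/002, cond-mat/0009057, math-ph/0603061, doi:10.1063/1.1664719, doi:10.1103/physrevlett.86.4207, doi:10.1142/s0129055x07002924, doi:10.1088/0305-4470/37/38/002, doi:10.1103/physrev.128.965, doi:10.1088/0305-4470/31/47/002, Richardson1968, DukelskyS]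

Barriers (technique_class: exact-solution, bethe-ansatz, integrable-anchor, deformation): - technique_class: exact-solution, bethe-ansatz, integrable-anchor, deformation
- Literature.Barriers.AtomisticToContinuum.EnergyAsymptoticsWithoutCondensation: lists
bethe-ansatz/exact-solution among its tokens but its audited scope
(EnergyAsymptoticsWithoutCondensationNarrow, caveat (e)) excludes an exact solution used for more
than the energy: rank 3 reads n₀ off the exact eigenstate (Hellmann–Feynman in ε₀), never from
two-order energy asymptotics; rank 2 is an operator homotopy, not energy matching. Respected on the
1-D witness (the same su(1,1) machinery with 1-D dispersion gives no BEC).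
- Literature.Barriers.AtomisticToContinuum.EnergyAsymptoticsWithoutCondensationNarrow: same — evaded
by construction for rank 3; rank 2's foreseen child PinnedRegime does use energy bounds,
legitimately, because for t < 1 the extensive pinning (1−t)Δ n₊ converts leading-order energy
precision into depletion bounds (evasion (i) of the entry with an O(1) instead of O(L⁻²) gap).
- Literature.Barriers.AtomisticToContinuum.BogoliubovPerturbationInfrared: APPLIES head-on to rank 2
at t → 1 (finite-order expansion in the cubic condensate vertices, d = 3, T = 0). Not evaded; the
bet is that expanding the gauge-invariant n₀ around a number-conserving INTERACTING integrable point
with exact propagators and Slavnov form factors has V-uniform second-order remainders where the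
expansion around the Gaussian Bogoliubov state has logarithms — to be tested first by the
Nepomnyashchy check on the anchor

History (route lifecycle, newest last):
- 2026-08-15T13:40:07Z · CLOSED retired — not-a-thesis: assembly does not conclude the sub-problem Statement (operator:999:1257524)

sub-problem: BoseEinsteinCondensation · status: closed(retired) · opened planner-plancard-AtomisticToContinuum-BoseEin-9977d9ee-0 2026-08-15T11:42:56Z · rev 0 · ledger route-AtomisticToContinuum-BECRichardsonAnchor
GENERATED by the gate from the ledger (D-0016/17). Provers cite these decls: `theorem foo : Summit.AtomisticToContinuum.BoseEinsteinCondensation.Theses.BECRichardsonAnchor.<Decl> := …` in Summits/AtomisticToContinuum/BoseEinsteinCondensation/Theorems/<Name>.lean.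
-/

namespace Summit.AtomisticToContinuum.BoseEinsteinCondensation.Theses.BECRichardsonAnchor

open scoped BigOperators Topology Manifold Classical MeasureTheory ProbabilityTheory Matrix InnerProductSpace ComplexConjugate ContinuousMap
open Filter Set Function TopologicalSpace MeasureTheory

attribute [summit_statement] _root_.BoseEinsteinCondensation

/-- item stmt-AtomisticToContinuum-5826 · crux · rank 2 · closed · moot by None · by planner
why it might fail: For t<1 the anchor's Δ-term pins the zero mode with extensive strength (1−t)2ργ, so gap arguments give c(t) with depletion ≲ o(1)/(1−t); uniformity as t→1 is soft-potential PeriodicBEC through the marginal d=3, T=0 infrared problem (BogoliubovPerturbationInfrared).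
sources: LiebSeiringerSolovejYngvason2005, Fournais2020, Benfatto1994, CenatiempoGiuliani2014, Griffin1993, Richardson1968
[crux] (card item RB, typed) For every repulsive finite-range v that is BOUNDED (v ≤ V₀; hard cores
excluded) and every cutoff Λ > 0 there is ρ₀ > 0 such that for 0 < ρ < ρ₀ there is c > 0 with: for
every t ∈ [0,1] and all large N (N = n+2, L = (N/ρ)^(1/3), γ = ∫v(|x|)dx, M = ⌊ΛL/2π⌋), every
periodic trial state Ψ whose deformed energy E_t(Ψ) = periodicEnergy(t·v)(Ψ) + (1−t)·[2ργ(N − n₀(Ψ))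
+ (γ/L⁹)(N(N−1)/2)∫|∫∫conj(w_Λ)Ψ|²] is within δ = δ(N,t) > 0 of its infimum has condensateOccupation
≥ cN. The constant c is uniform along the homotopy H_t = (1−t)H_R + tH_v; t = 1 is PeriodicBEC
(stmt-0826 body) for bounded v, t = 0 is the anchor. [deps: RichardsonAnchorBEC] [difficulty:
open-problem] -/
@[route_item "route-AtomisticToContinuum-BECRichardsonAnchor"]
def BeliaevDeformationBEC : Prop :=
  ∀ (v : ℝ → ENNReal) (V₀ Λ : ℝ), Literature.MathematicalPhysics.QuantumManyBody.BoseGas.IsRepulsiveFiniteRange v → (∀ r, v r ≤ ENNReal.ofReal V₀) → 0 < Λ → ∃ ρ₀ : ℝ, 0 < ρ₀ ∧ ∀ ρ : ℝ, 0 < ρ → ρ < ρ₀ → ∃ c : ℝ, 0 < c ∧ ∀ t : ℝ, 0 ≤ t → t ≤ 1 → ∀ᶠ n : ℕ in Filter.atTop, let N : ℕ := n + 2; let L : ℝ := Literature.MathematicalPhysics.QuantumManyBody.BoseGas.sideLength ρ N; let γ : ℝ := (∫⁻ x : EuclideanSpace ℝ (Fin 3), v ‖x‖).toReal; let M : ℕ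 := ⌊Λ * L / (2 * Real.pi)⌋₊; let w : EuclideanSpace ℝ (Fin 3) → EuclideanSpace ℝ (Fin 3) → ℂ := fun x y => ∑ m ∈ Fintype.piFinset (fun _ : Fin 3 => Finset.Icc (-(M : ℤ)) M), Complex.exp (2 * Real.pi * Complex.I / L * ∑ j : Fin 3, (m j : ℂ) * ((x j - y j : ℝ) : ℂ)); let E : Literature.MathematicalPhysics.QuantumManyBody.BoseGas.PeriodicTrialState N L → ENNReal := fun Φ => Literature.MathematicalPhysics.QuantumManyBody.BoseGas.periodicEnergy (fun r => ENNReal.ofReal t * v r) Φ + ENNReal.ofReal (1 - t) * (ENNReal.ofReal (2 * ρ * γ) * ((N : ENNReal) - Literature.MathematicalPhysics.QuantumManyBody.BoseGas.condensateOccupation N L Φ.ψ) + ENNReal.ofReal (γ / L ^ 9 * ((N : ℝ) * (N - 1) / 2)) * ∫⁻ Y in Literature.MathematicalPhysics.QuantumManyBody.BoseGas.cellN n L, (‖∫ x in Literature.MathematicalPhysics.QuantumManyBody.BoseGas.cell L, ∫ y in Literature.MathematicalPhysics.QuantumManyBody.BoseGas.cell L, (starRingEnd ℂ) (w x y) * Φ.ψ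 (Matrix.vecCons x (Matrix.vecCons y Y))‖₊ : ENNReal) ^ 2); ∃ δ : ENNReal, 0 < δ ∧ ∀ Ψ : Literature.MathematicalPhysics.QuantumManyBody.BoseGas.PeriodicTrialState N L, E Ψ ≤ (⨅ Φ, E Φ) + δ → ENNReal.ofReal (c * N) ≤ Literature.MathematicalPhysics.QuantumManyBody.BoseGas.condensateOccupation N L Ψ.ψ

/-- item stmt-AtomisticToContinuum-5827 · crux · rank 3 · closed · moot by None · by planner
why it might fail: At Δ=2ργ the anchor is only self-consistently stable (Bogoliubov A(0)−B = 2(ρ−ρ₀)γ closes with the depletion); Richardson1968/DukelskySchuck2001 find a FRAGMENTED phase (levels 0,1) at strong repulsive pairing; PZ2007 Rem 1.2: without exchange shift repulsive pairing is invisible in the TL.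
sources: Richardson1968, DukelskySchuck2001, DukelskyPittelSierra2004, RomanSierraDukelsky2002, PuleZagrebnov2007, Luban1962
[crux] (card item RA, typed; the anchor theorem) For all γ, Λ > 0 there are C and ρ₀ > 0 such that
for 0 < ρ < ρ₀ and all large N (N = n+2, L = (N/ρ)^(1/3), M = ⌊ΛL/2π⌋), every periodic trial state Ψ
within δ = δ(N) > 0 of the infimum of the anchor energy E_R(Φ) = ∫|∇Φ|² + 2ργ(N − n₀(Φ)) +
(γ/L⁹)(N(N−1)/2)∫_(cell^(N−2))|∫∫conj(w_Λ(x,y))Φ(x,y,Y)dxdy|²dY has n₀(Ψ) = condensateOccupation ≥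
(1 − C√(ργ³))·N: thermodynamic-limit BEC at the Bogoliubov rate for the ground state of H_R = Σ_k
(k²+2ργ[k≠0]) n_k + (γ/2V) Σ_(k,k'∈B_Λ) a†_k a†_(−k) a_(−k') a_(k') — Richardson's repulsive su(1,1)
pairing model (levels k²+Δ, ε₀ = 0, coupling g = 2γ/V), read off its ground-state Bethe roots (all
real, in (2η₀, 2η₁) per DukelskySchuck2001) or, alternatively, by the approximating-Hamiltonian
method plus the model's own V-independent gap. [difficulty: L] -/
@[route_item "route-AtomisticToContinuum-BECRichardsonAnchor"]
def RichardsonAnchorBEC : Prop :=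
  ∀ γ Λ : ℝ, 0 < γ → 0 < Λ → ∃ C ρ₀ : ℝ, 0 < ρ₀ ∧ ∀ ρ : ℝ, 0 < ρ → ρ < ρ₀ → ∀ᶠ n : ℕ in Filter.atTop, let N : ℕ := n + 2; let L : ℝ := Literature.MathematicalPhysics.QuantumManyBody.BoseGas.sideLength ρ N; let M : ℕ := ⌊Λ * L / (2 * Real.pi)⌋₊; let w : EuclideanSpace ℝ (Fin 3) → EuclideanSpace ℝ (Fin 3) → ℂ := fun x y => ∑ m ∈ Fintype.piFinset (fun _ : Fin 3 => Finset.Icc (-(M : ℤ)) M), Complex.exp (2 * Real.pi * Complex.I / L * ∑ j : Fin 3, (m j : ℂ) * ((x j - y j : ℝ) : ℂ)); let E : Literature.MathematicalPhysics.QuantumManyBody.BoseGas.PeriodicTrialState N L → ENNReal := fun Φ => Literature.MathematicalPhysics.QuantumManyBody.BoseGas.periodicEnergy 0 Φ + ENNReal.ofReal (2 * ρ * γ) * ((N : ENNReal) - Literature.MathematicalPhysics.QuantumManyBody.BoseGas.condensateOccupation N L Φ.ψ) + ENNReal.ofReal (γ / L ^ 9 * ((N : ℝ) * (N - 1) / 2))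 * ∫⁻ Y in Literature.MathematicalPhysics.QuantumManyBody.BoseGas.cellN n L, (‖∫ x in Literature.MathematicalPhysics.QuantumManyBody.BoseGas.cell L, ∫ y in Literature.MathematicalPhysics.QuantumManyBody.BoseGas.cell L, (starRingEnd ℂ) (w x y) * Φ.ψ (Matrix.vecCons x (Matrix.vecCons y Y))‖₊ : ENNReal) ^ 2; ∃ δ : ENNReal, 0 < δ ∧ ∀ Ψ : Literature.MathematicalPhysics.QuantumManyBody.BoseGas.PeriodicTrialState N L, E Ψ ≤ (⨅ Φ, E Φ) + δ → ENNReal.ofReal ((1 - C * Real.sqrt (ρ * γ ^ 3)) * N) ≤ Literature.MathematicalPhysics.QuantumManyBody.BoseGas.condensateOccupation N L Ψ.ψ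

/-- item stmt-AtomisticToContinuum-0827 · crux · rank 4 · open · by planner
why it might fail: PeriodicBEC(v) is ground-state-only (δ after N) at the box (N/ρ)^{1/3}: the Dirichlet GS is a periodic trial state but lies a wall term ≫δ above E₀^per; interior restrictions are neither periodic nor of sharp N, so the hypothesis may never fire (transfer≈conjunct). BEC is BC-sensitive: Robinson1976.
sources: LiebSeiringerSolovejYngvason2005, Basti2022, BoccatoSeiringer2023, Junge2026, Robinson1976, LauwersVerbeureZagrebnov2003
[crux] BoundaryTransferWeak (mode-free boundary-condition transfer, per potential): for each
repulsive finite-range v, PeriodicBEC(v) implies ∃ρ₀>0 ∀ρ∈(0,ρ₀) HasGroundStateBEC v ρ (Dirichlet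
ground state, λ_max(γ) ≥ cN via condensateNumber). Not glue: near-minimiser slacks are O(N/L²) while
Dirichlet/periodic energies differ by a boundary term ≫ N/L², so no energy-comparison proof;
expected route: Neumann bracketing of interior sub-boxes (−Δ_Dir ≥ ⊕−Δ_Neu, v ≥ 0) + a mode-free
criterion (λ_max ≥ tr γ²/N). Only the ENERGY analogue is in print (LiebSeiringerSolovejYngvason2005
Ch. 2 after (2.8)). v ≡ 0: hypothesis and conclusion both true. -/
@[route_item "route-AtomisticToContinuum-BECRichardsonAnchor"]
def BoundaryTransferWeak : Prop :=
  ∀ v : ℝ → ENNReal, Literature.MathematicalPhysics.QuantumManyBody.BoseGas.IsRepulsiveFiniteRange v → (∃ ρ₀ : ℝ, 0 < ρ₀ ∧ ∀ ρ : ℝ, 0 < ρ → ρ < ρ₀ → ∃ c : ℝ, 0 < c ∧ ∀ᶠ N : ℕ in Filter.atTop, ∃ δ : ENNReal, 0 < δ ∧ ∀ Ψ : Literature.MathematicalPhysics.QuantumManyBody.BoseGas.PeriodicTrialState N (Literature.MathematicalPhysics.QuantumManyBody.BoseGas.sideLength ρ N), Literature.MathematicalPhysics.QuantumManyBody.BoseGas.periodicEnergy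 v Ψ ≤ Literature.MathematicalPhysics.QuantumManyBody.BoseGas.periodicGroundStateEnergy v N (Literature.MathematicalPhysics.QuantumManyBody.BoseGas.sideLength ρ N) + δ → ENNReal.ofReal (c * N) ≤ Literature.MathematicalPhysics.QuantumManyBody.BoseGas.condensateOccupation N (Literature.MathematicalPhysics.QuantumManyBody.BoseGas.sideLength ρ N) Ψ.ψ) → ∃ ρ₀ : ℝ, 0 < ρ₀ ∧ ∀ ρ : ℝ, 0 < ρ → ρ < ρ₀ → Literature.MathematicalPhysics.QuantumManyBody.BoseGas.HasGroundStateBEC v ρ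

/-- item stmt-AtomisticToContinuum-5828 · support · rank 9 · closed · moot by None · by planner
sources: LiebSeiringerSolovejYngvason2005, Fournais2020, Junge2026
[support] The complement class, filed so that the assembly is honest: for every repulsive
finite-range v that is NOT bounded (∀V₀ ∃r, v(r) > V₀ — hard cores v = ⊤·1_[0,a] and other singular
profiles) the PeriodicBEC conclusion holds (∃ρ₀ ∀ρ<ρ₀ ∃c ∀ᶠN ∃δ: δ-near-minimisers of periodicEnergy
v on the torus (N/ρ)^(1/3) have condensateOccupation ≥ cN). This is PeriodicBEC
(stmt-AtomisticToContinuum-0826) restricted to unbounded v and closes when 0826 closes; this line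
offers no mechanism for it (a t-matrix-renormalised anchor would be a different card). Not to be
worked inside this route. [difficulty: open-problem] -/
@[route_item "route-AtomisticToContinuum-BECRichardsonAnchor"]
def UnboundedPotentialPeriodicBEC : Prop :=
  ∀ v : ℝ → ENNReal, Literature.MathematicalPhysics.QuantumManyBody.BoseGas.IsRepulsiveFiniteRange v → (¬ ∃ V₀ : ℝ, ∀ r, v r ≤ ENNReal.ofReal V₀) → ∃ ρ₀ : ℝ, 0 < ρ₀ ∧ ∀ ρ : ℝ, 0 < ρ → ρ < ρ₀ → ∃ c : ℝ, 0 < c ∧ ∀ᶠ N : ℕ in Filter.atTop, ∃ δ : ENNReal, 0 < δ ∧ ∀ Ψ : Literature.MathematicalPhysics.QuantumManyBody.BoseGas.PeriodicTrialState N (Literature.MathematicalPhysics.QuantumManyBody.BoseGas.sideLength ρ N), Literature.MathematicalPhysics.QuantumManyBody.BoseGas.periodicEnergy v Ψ ≤ Literature.MathematicalPhysics.QuantumManyBody.BoseGas.periodicGroundStateEnergy v N (Literature.MathematicalPhysics.QuantumManyBody.BoseGas.sideLength ρ N) + δ → ENNReal.ofReal (c * N) ≤ Literature.MathematicalPhysics.QuantumManyBody.BoseGas.condensateOccupation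 N (Literature.MathematicalPhysics.QuantumManyBody.BoseGas.sideLength ρ N) Ψ.ψ

/-- item stmt-AtomisticToContinuum-5829 · assembly · rank 1 · closed · moot by None · by planner
sources: LiebSeiringerSolovejYngvason2005
[assembly] BeliaevDeformationBEC → UnboundedPotentialPeriodicBEC → BoundaryTransferWeak →
BoseEinsteinCondensation. -/
@[route_item "route-AtomisticToContinuum-BECRichardsonAnchor"]
def Assembly : Prop :=
  BeliaevDeformationBEC → UnboundedPotentialPeriodicBEC → BoundaryTransferWeak → Literature.MathematicalPhysics.QuantumManyBody.BoseGas.BoseEinsteinCondensation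

end Summit.AtomisticToContinuum.BoseEinsteinCondensation.Theses.BECRichardsonAnchor
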